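import Summits.CriticalPhenomena.PercolationContinuityZ3.Theorems.PercNearOneGluingNoHeavyLowerTailApexForestPreFKGAlgebra
import Summits.CriticalPhenomena.PercolationContinuityZ3.Theorems.PercNearOneGluingNoHeavyLowerTailApexForestGluingRecursion
import HarnessLib

/-!
# Kozma–Nitzan CONJECTURE 2 on APEX-FOREST graphs — the whole forest induction, machine-checked on the gluing recursion
# (`NoHeavyLowerTail` cell, stmt-CriticalPhenomena-4575; new-inequality factory seat `prim-ineq-gen-7`, gen 3)

Support file (`--supports stmt-CriticalPhenomena-4575`).  Pure real algebra over an inductive type of weighted rooted trees; no measure theory, no named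
facts, no sorries.  Companion of `…ApexForestPreFKGAlgebra` (the step) and the Conjecture-1 files `…ApexForestGluingAlgebra/Recursion`.

The GLUING RECURSION of an apex-forest instance (paper proof run/shared/lean/prim/prim-ineq-gen-7/PROOF-CONJ2-APEXFOREST.md): a rooted tree is a vertex
(`leaf ρ rel`, hub-avoidance factor `ρ`, relay flag) or a tree with one more child subtree attached to its root (`cons T' q T₁`);
`g` / `h` = P(root cluster hub-free) / P(… and relay-free) and, per relay, the triple `(d, e, ζ)` = (P(α ↮ hub), P(α's cluster hub-free and contains the
root), P(root cluster hub-free & relay-free and α's cluster hub-free)), transported through `cons` by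
`(d,e,ζ) ↦ (d − q(1−a)e, e·q·a, b((1−q)d + qζ))` for relays of the child (`a,b` = `g,h` of the root block) and
`(d,e,ζ) ↦ (d − q(1−g₁)e, e·G, ζ·H)` for relays of the root block (`G = 1 − q(1−g₁)`, `H = 1 − q(1−h₁)`).
INVARIANTS (the 'five facts', here PROVED to propagate through the recursion): `0 ≤ e ≤ g − h`, `0 ≤ ζ`, `h·d ≤ ζ ≤ h`, `e + ζ ≤ d ≤ 1`.
THEOREM `ApexForestPreFKGRec.preFKG_le`: if the tree has a relay, some relay triple satisfies `g − h ≤ d − ζ` — read probabilistically,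
`P(o ↔ A, o ↮ b) ≤ P(α ↮ b, o ↔ A ∪ {b})`, Kozma–Nitzan's (3) for `A ∪ {b}`, hence their CONJECTURE 2 on every apex-forest graph, uniformly in the number of
relays, depth and branching.  (The identification recursion = percolation is three cluster facts + independence across a forest edge + Harris for the lower
bound `ζ ≥ h·d`; it is not formalised here.)
[cite: KozmaNitzan2024, Conjecture 2 and (3) (p. 3)]
-/

namespace Summit.CriticalPhenomena.PercolationContinuityZ3.Theorems

namespace ApexForestPreFKGRec

open ApexForestRec ApexForestRec.RT

/-- Relay triples `(d, e, ζ)` transported through the gluing recursion of `ApexForestRec.RT` (the rooted weighted trees of the Conjecture-1 file).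
[this file] -/
def vals3 : RT → List (ℝ × ℝ × ℝ)
  | .leaf ρ rel => if rel then [(ρ, ρ, 0)] else []
  | .cons T' q T₁ =>
      (vals3 T').map (fun p => (p.1 - q * (1 - g T₁) * p.2.1, p.2.1 * (1 - q * (1 - g T₁)), p.2.2 * (1 - q * (1 - h T₁)))) ++
        (vals3 T₁).map (fun p => (p.1 - q * (1 - g T') * p.2.1, p.2.1 * q * g T', h T' * ((1 - q) * p.1 + q * p.2.2)))

/-- No relay triples ⇒ `g = h`. [this file] -/
theorem g_eq_h_of_vals3_nil : ∀ T : RT, vals3 T = [] → T.g = T.h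
  | .leaf ρ rel, hv => by
      cases rel
      · simp [RT.g, RT.h]
      · simp [vals3] at hv
  | .cons T' q T₁, hv => by
      simp only [vals3, List.append_eq_nil_iff, List.map_eq_nil_iff] at hv
      simp only [RT.g, RT.h, g_eq_h_of_vals3_nil T' hv.1, g_eq_h_of_vals3_nil T₁ hv.2]

/-- **The five facts propagate**: every transported relay triple satisfies `0 ≤ e ≤ g − h`, `h d ≤ ζ ≤ h`, `e + ζ ≤ d ≤ 1`. [this file] -/
theorem vals_facts : ∀ T : RT, T.wf → ∀ p ∈ vals3 T,
    0 ≤ p.2.1 ∧ p.2.1 ≤ T.g - T.h ∧ 0 ≤ p.2.2 ∧ T.h * p.1 ≤ p.2.2 ∧ p.2.2 ≤ T.h ∧ p.2.1 + p.2.2 ≤ p.1 ∧ p.1 ≤ 1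
  | .leaf ρ rel, hw, p, hp => by
      rcases hw with ⟨h0, h1⟩
      cases rel
      · simp [vals3] at hp
      · simp [vals3] at hp
        subst hp
        simp [RT.g, RT.h, h0, h1]
  | .cons T' q T₁, hw, p, hp => by
      rcases hw with ⟨hw', ⟨hq0, hq1⟩, hw₁⟩
      obtain ⟨h0', hhg', hg1'⟩ := bounds T' hw'
      obtain ⟨h0₁, hhg₁, hg1₁⟩ := bounds T₁ hw₁
      simp only [vals3, List.mem_append, List.mem_map] at hp
      simp only [RT.g, RT.h]
      have hG0 : 0 ≤ 1 - q * (1 - T₁.g) := by nlinarith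
      have hG1 : 1 - q * (1 - T₁.g) ≤ 1 := by nlinarith
      have hH0 : 0 ≤ 1 - q * (1 - T₁.h) := by nlinarith
      have hH1 : 1 - q * (1 - T₁.h) ≤ 1 := by nlinarith
      have hHG : 1 - q * (1 - T₁.h) ≤ 1 - q * (1 - T₁.g) := by nlinarith
      rcases hp with ⟨p', hp', rfl⟩ | ⟨p₁, hp₁, rfl⟩
      · -- root-block relay: (d' − q(1−g₁)e', e'G, ζ'H)
        obtain ⟨he0, heX, hz0, hzl, hzu, hez, hd1⟩ := vals_facts T' hw' p' hp'
        have hqg : 0 ≤ q * (1 - T₁.g) := mul_nonneg hq0 (by linarith)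
        refine ⟨mul_nonneg he0 hG0, ?_, mul_nonneg hz0 hH0, ?_, ?_, ?_, ?_⟩
        · -- e'G ≤ X_T = aG − bH  (X_T − (a−b)G = b q (g₁−h₁) ≥ 0)
          nlinarith [mul_le_mul_of_nonneg_right heX hG0, mul_nonneg (mul_nonneg h0' hq0) (sub_nonneg.2 hhg₁)]
        · -- h_T d_T = bH (d' − q(1−g₁)e') ≤ ζ'H   ⟸  b d' ≤ ζ'  and q(1−g₁)e' ≥ 0
          have h1 : T'.h * (p'.1 - q * (1 - T₁.g) * p'.2.1) ≤ p'.2.2 := by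
            nlinarith [mul_nonneg h0' (mul_nonneg hqg he0)]
          nlinarith [mul_le_mul_of_nonneg_right h1 hH0]
        · -- ζ'H ≤ bH
          exact mul_le_mul_of_nonneg_right hzu hH0
        · -- e'G + ζ'H ≤ d' − q(1−g₁)e'   (= d' − e' − ζ'H ≥ d' − e' − ζ' ≥ 0)
          nlinarith [mul_nonneg hz0 (sub_nonneg.2 hH1)]
        · nlinarith [mul_nonneg hqg he0]
      · -- child relay: (d − q(1−a)e, e q a, b((1−q)d + qζ))
        obtain ⟨he0, heX, hz0, hzl, hzu, hez, hd1⟩ := vals_facts T₁ hw₁ p₁ hp₁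
        have ha0 : 0 ≤ T'.g := le_trans h0' hhg'
        have hqa : 0 ≤ q * (1 - T'.g) := mul_nonneg hq0 (by linarith)
        have hd0 : 0 ≤ p₁.1 := le_trans (add_nonneg he0 hz0) hez
        refine ⟨by positivity, ?_, ?_, ?_, ?_, ?_, ?_⟩
        · -- e q a ≤ a q (g₁−h₁) ≤ X_T
          nlinarith [mul_le_mul_of_nonneg_left heX (mul_nonneg hq0 ha0), mul_nonneg (sub_nonneg.2 hhg') hH0]
        · -- 0 ≤ b((1−q)d + qζ)
          have : 0 ≤ (1 - q) * p₁.1 + q * p₁.2.2 := by nlinarith [mul_nonneg (sub_nonneg.2 hq1) hd0, mul_nonneg hq0 hz0]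
          exact mul_nonneg h0' this
        · -- bH (d − q(1−a)e) ≤ b((1−q)d + qζ)
          have h1 : (1 - q * (1 - T₁.h)) * (p₁.1 - q * (1 - T'.g) * p₁.2.1) ≤ (1 - q) * p₁.1 + q * p₁.2.2 := by
            nlinarith [mul_le_mul_of_nonneg_left hzl hq0, mul_nonneg hH0 (mul_nonneg hqa he0)]
          nlinarith [mul_le_mul_of_nonneg_left h1 h0']
        · -- b((1−q)d + qζ) ≤ bH = b(1 − q + q h₁)  ⟸ d ≤ 1, ζ ≤ h₁
          have h1 : (1 - q) * p₁.1 + q * p₁.2.2 ≤ 1 - q * (1 - T₁.h) := by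
            nlinarith [mul_le_mul_of_nonneg_left hd1 (sub_nonneg.2 hq1), mul_le_mul_of_nonneg_left hzu hq0]
          exact mul_le_mul_of_nonneg_left h1 h0'
        · -- e q a + b((1−q)d + qζ) ≤ d − q(1−a)e :  RHS − LHS ≥ d(1−b)(1−q) ≥ 0
          have hb1' : T'.h ≤ 1 := le_trans hhg' hg1'
          have h2 : q * (p₁.2.1 + T'.h * p₁.2.2) ≤ q * p₁.1 := by
            apply mul_le_mul_of_nonneg_left _ hq0
            nlinarith [mul_le_mul_of_nonneg_right hb1' hz0]
          nlinarith [mul_nonneg (mul_nonneg (sub_nonneg.2 hb1') (sub_nonneg.2 hq1)) hd0, mul_nonneg hq0 he0,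
            mul_nonneg (sub_nonneg.2 hg1') (mul_nonneg hq0 he0)]
        · nlinarith [mul_nonneg hqa he0]

/-- **Conjecture 2 / (3) on the gluing recursion**: if the tree has a relay, some transported relay triple `(d,e,ζ)` satisfies `g − h ≤ d − ζ`.
[cite: KozmaNitzan2024, (3) (p. 3)] -/
theorem preFKG_le : ∀ T : RT, T.wf → vals3 T ≠ [] → ∃ p ∈ vals3 T, T.g - T.h ≤ p.1 - p.2.2
  | .leaf ρ rel, hw, hne => by
      cases rel
      · simp [vals3] at hne
      · exact ⟨(ρ, ρ, 0), by simp [vals3], by simp [RT.g, RT.h]⟩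
  | .cons T' q T₁, hw, hne => by
      rcases hw with ⟨hw', ⟨hq0, hq1⟩, hw₁⟩
      obtain ⟨h0', hhg', hg1'⟩ := bounds T' hw'
      obtain ⟨h0₁, hhg₁, hg1₁⟩ := bounds T₁ hw₁
      have hH0 : 0 ≤ 1 - q * (1 - T₁.h) := by nlinarith
      have hH1 : 1 - q * (1 - T₁.h) ≤ 1 := by nlinarith
      -- transported values are nonnegative-ish lower bounds used in degenerate cases
      by_cases hb1 : T'.h = 1
      · -- a = b = 1: X_T = q (g₁ − h₁); a child relay is needed unless X_T = 0
        have ha1 : T'.g = 1 := le_antisymm hg1' (hb1 ▸ hhg')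
        by_cases hv₁ : vals3 T₁ = []
        · -- no child relay: g₁ = h₁, X_T = 0; any root relay works (d − ζ ≥ e ≥ 0)
          have hv' : vals3 T' ≠ [] := by intro h'; apply hne; simp [vals3, h', hv₁]
          obtain ⟨p', hp'⟩ := List.exists_mem_of_ne_nil _ hv'
          obtain ⟨he0, heX, hz0, hzl, hzu, hez, hd1⟩ := vals_facts T' hw' p' hp'
          refine ⟨_, by simp only [vals3, List.mem_append, List.mem_map]; exact Or.inl ⟨p', hp', rfl⟩, ?_⟩
          simp only [RT.g, RT.h, ha1, hb1, g_eq_h_of_vals3_nil T₁ hv₁]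
          have he_le : p'.2.1 ≤ p'.1 := by linarith
          nlinarith [mul_nonneg hz0 (sub_nonneg.2 hH1), mul_nonneg (sub_nonneg.2 (show q * (1 - T₁.g) ≤ 1 by nlinarith)) he0]
        · obtain ⟨p₁, hp₁, hc₁⟩ := preFKG_le T₁ hw₁ hv₁
          obtain ⟨he0, heX, hz0, hzl, hzu, hez, hd1⟩ := vals_facts T₁ hw₁ p₁ hp₁
          refine ⟨_, by simp only [vals3, List.mem_append, List.mem_map]; exact Or.inr ⟨p₁, hp₁, rfl⟩, ?_⟩
          simp only [RT.g, RT.h, ha1, hb1]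
          nlinarith [mul_le_mul_of_nonneg_left hc₁ hq0]
      by_cases hh1 : T₁.h = 1
      · -- g₁ = h₁ = 1: G = H = 1, X_T = a − b; a root relay is needed unless X_T = 0
        have hg1 : T₁.g = 1 := le_antisymm hg1₁ (hh1 ▸ hhg₁)
        by_cases hv' : vals3 T' = []
        · have hv₁ : vals3 T₁ ≠ [] := by intro h'; apply hne; simp [vals3, h', hv']
          obtain ⟨p₁, hp₁⟩ := List.exists_mem_of_ne_nil _ hv₁
          obtain ⟨he0, heX, hz0, hzl, hzu, hez, hd1⟩ := vals_facts T₁ hw₁ p₁ hp₁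
          refine ⟨_, by simp only [vals3, List.mem_append, List.mem_map]; exact Or.inr ⟨p₁, hp₁, rfl⟩, ?_⟩
          simp only [RT.g, RT.h, hg1, hh1, g_eq_h_of_vals3_nil T' hv']
          have hb1' : T'.h ≤ 1 := le_trans hhg' hg1'
          have hd0 : 0 ≤ p₁.1 := le_trans (add_nonneg he0 hz0) hez
          have hqa : 0 ≤ q * (1 - T'.h) := mul_nonneg hq0 (by linarith)
          have he_le : p₁.2.1 ≤ p₁.1 := by linarith
          have hz_le : p₁.2.2 ≤ p₁.1 := by linarith
          nlinarith [mul_le_mul_of_nonneg_left he_le hqa, mul_le_mul_of_nonneg_left hz_le (mul_nonneg h0' hq0),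
            mul_nonneg (mul_nonneg (sub_nonneg.2 hb1') (sub_nonneg.2 hq1)) hd0]
        · obtain ⟨p', hp', hc'⟩ := preFKG_le T' hw' hv'
          refine ⟨_, by simp only [vals3, List.mem_append, List.mem_map]; exact Or.inl ⟨p', hp', rfl⟩, ?_⟩
          simp only [RT.g, RT.h, hg1, hh1]
          nlinarith
      -- main case: b < 1, h₁ < 1
      have hb1' : T'.h < 1 := lt_of_le_of_ne (le_trans hhg' hg1') hb1
      have hh1' : T₁.h < 1 := lt_of_le_of_ne (le_trans hhg₁ hg1₁) hh1
      -- certificates (real or dummy zero)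
      have cert' : ∃ p' : ℝ × ℝ × ℝ, (p' ∈ vals3 T' ∨ (vals3 T' = [] ∧ p' = (0, 0, 0))) ∧
          p'.2.1 ≤ T'.g - T'.h ∧ T'.h * p'.1 ≤ p'.2.2 ∧ T'.g - T'.h ≤ p'.1 - p'.2.2 := by
        by_cases hv' : vals3 T' = []
        · refine ⟨(0, 0, 0), Or.inr ⟨hv', rfl⟩, ?_, by simp, ?_⟩
          · simp [g_eq_h_of_vals3_nil T' hv']
          · simp [g_eq_h_of_vals3_nil T' hv']
        · obtain ⟨p', hp', hc'⟩ := preFKG_le T' hw' hv'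
          obtain ⟨he0, heX, hz0, hzl, hzu, hez, hd1⟩ := vals_facts T' hw' p' hp'
          exact ⟨p', Or.inl hp', heX, hzl, hc'⟩
      have cert₁ : ∃ p₁ : ℝ × ℝ × ℝ, (p₁ ∈ vals3 T₁ ∨ (vals3 T₁ = [] ∧ p₁ = (0, 0, 0))) ∧
          p₁.2.1 ≤ T₁.g - T₁.h ∧ T₁.h * p₁.1 ≤ p₁.2.2 ∧ T₁.g - T₁.h ≤ p₁.1 - p₁.2.2 := by
        by_cases hv₁ : vals3 T₁ = []
        · refine ⟨(0, 0, 0), Or.inr ⟨hv₁, rfl⟩, ?_, by simp, ?_⟩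
          · simp [g_eq_h_of_vals3_nil T₁ hv₁]
          · simp [g_eq_h_of_vals3_nil T₁ hv₁]
        · obtain ⟨p₁, hp₁, hc₁⟩ := preFKG_le T₁ hw₁ hv₁
          obtain ⟨he0, heX, hz0, hzl, hzu, hez, hd1⟩ := vals_facts T₁ hw₁ p₁ hp₁
          exact ⟨p₁, Or.inl hp₁, heX, hzl, hc₁⟩
      obtain ⟨p', hp'or, heX', hzl', hc'⟩ := cert'
      obtain ⟨p₁, hp₁or, heX₁, hzl₁, hc₁⟩ := cert₁
      have key := ApexForestPreFKG.step3 T'.g T'.h T₁.g T₁.h q p₁.1 p₁.2.1 p₁.2.2 p'.1 p'.2.1 p'.2.2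
        h0' hg1' h0₁ hg1₁ hq0 hq1 hb1' hh1' heX₁ hzl₁ hc₁ heX' hzl' hc'
      -- which candidate wins?
      rcases le_total (p'.1 - q * (1 - T₁.g) * p'.2.1 - (1 - q * (1 - T₁.h)) * p'.2.2)
          (p₁.1 * (1 - T'.h + T'.h * q) - q * (1 - T'.g) * p₁.2.1 - T'.h * q * p₁.2.2) with hle | hle
      · -- child candidate dominates
        rw [max_eq_left hle] at key
        rcases hp₁or with hp₁ | ⟨hv₁, rfl⟩
        · refine ⟨_, by simp only [vals3, List.mem_append, List.mem_map]; exact Or.inr ⟨p₁, hp₁, rfl⟩, ?_⟩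
          simp only [RT.g, RT.h]
          nlinarith [key]
        · -- dummy child: then LHS ≤ 0 ≤ any root relay's value; root block must have a relay
          have hv' : vals3 T' ≠ [] := by intro h'; apply hne; simp [vals3, h', hv₁]
          rcases hp'or with hp' | ⟨hv'', _⟩
          · obtain ⟨he0, heX, hz0, hzl, hzu, hez, hd1⟩ := vals_facts T' hw' p' hp'
            refine ⟨_, by simp only [vals3, List.mem_append, List.mem_map]; exact Or.inl ⟨p', hp', rfl⟩, ?_⟩
            simp only [RT.g, RT.h]
            simp at key
            have r0 : 0 ≤ p'.1 - q * (1 - T₁.g) * p'.2.1 - (1 - q * (1 - T₁.h)) * p'.2.2 := by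
              nlinarith [mul_nonneg hz0 (sub_nonneg.2 hH1), mul_nonneg (sub_nonneg.2 (show q * (1 - T₁.g) ≤ 1 by nlinarith)) he0]
            linarith
          · exact absurd hv'' hv'
      · rw [max_eq_right hle] at key
        rcases hp'or with hp' | ⟨hv', rfl⟩
        · refine ⟨_, by simp only [vals3, List.mem_append, List.mem_map]; exact Or.inl ⟨p', hp', rfl⟩, ?_⟩
          simp only [RT.g, RT.h]
          nlinarith [key]
        · have hv₁ : vals3 T₁ ≠ [] := by intro h'; apply hne; simp [vals3, h', hv']
          rcases hp₁or with hp₁ | ⟨hv'', _⟩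
          · obtain ⟨he0, heX, hz0, hzl, hzu, hez, hd1⟩ := vals_facts T₁ hw₁ p₁ hp₁
            refine ⟨_, by simp only [vals3, List.mem_append, List.mem_map]; exact Or.inr ⟨p₁, hp₁, rfl⟩, ?_⟩
            simp only [RT.g, RT.h]
            simp at key
            have hb1'' : T'.h ≤ 1 := le_trans hhg' hg1'
            have hd0 : 0 ≤ p₁.1 := le_trans (add_nonneg he0 hz0) hez
            have hqa : 0 ≤ q * (1 - T'.g) := mul_nonneg hq0 (by linarith)
            have he_le : p₁.2.1 ≤ p₁.1 := by linarith
            have hz_le : p₁.2.2 ≤ p₁.1 := by linarith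
            have r0 : 0 ≤ p₁.1 - q * (1 - T'.g) * p₁.2.1 - T'.h * ((1 - q) * p₁.1 + q * p₁.2.2) := by
              nlinarith [mul_le_mul_of_nonneg_left he_le hqa, mul_le_mul_of_nonneg_left hz_le (mul_nonneg h0' hq0),
                mul_nonneg (mul_nonneg (sub_nonneg.2 hb1'') (sub_nonneg.2 hq1)) hd0, mul_nonneg (mul_nonneg hq0 (sub_nonneg.2 hhg')) hd0]
            linarith
          · exact absurd hv'' hv₁

end ApexForestPreFKGRec

end Summit.CriticalPhenomena.PercolationContinuityZ3.Theorems
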